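import Summits.NavierStokesRegularity.NavierStokesRegularity.Theorems.TerminalTraceTypeITraceScarL3LayerDecaySubTypeI

set_option linter.dupNamespace false

/-!
# The terminal-layer exponent `β* = 1/2` (nsreg-p2 g30, ROUND-33) — part 2/3: the item in the class

Part 1/3 (`…LayerDecaySubTypeI.lean`, `subTypeI_of_layerDecay`): terminal-layer decay `X(σ) ≤ ε√σ`
plus the one-sided Lipschitz companion make the solution locally sub-Type-I at `x₀`.  This file:
`cknC_le_of_rate_of_morrey` (a local rate `√(T−t)|u| ≤ ε` and Morrey slices `≤ M r` give
`C(r) ≤ 2εM`) and `typeITraceScarL3_unitViscosity_of_layerDecay` — item 18385's conclusion at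
`ν = 1` in the class «Lipschitz companion ∧ layer decay ∧ `p ∈ L^{3/2}(Q_R)`», closed by Seregin's
cubic lower bound at a backward-singular point.  Type I is used three times (`morrey_of_typeI`,
`exists_typeI_rate_window`, `scaledEnergies_bounded_of_typeIRate`); no carried hypothesis.
Part 3/3 (`…LayerDecayPressureOsc.lean`, plate v1.1) discharges the Lipschitz companion onto a
scaled pressure-oscillation bound.
(Plate t34 of nsreg-p2 g30, split in three files of at most 400 lines for the gate; the declarations
are those of the plate with the local notation `E3` spelled out as `EuclideanSpace ℝ (Fin 3)`.)
-/

noncomputable section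

open MeasureTheory Set Function Metric Filter Topology Literature.Analysis.FluidPDE
open scoped ENNReal NNReal

namespace Summit.NavierStokesRegularity.NavierStokesRegularity.Theorems.TypeITraceScarL3

/-- **The scaled cubic functional under a local Type-I rate and a Morrey bound:**
`C(r; (T,x₀)) ≤ 2 ε M` if `√(T−t) |u(t,x)| ≤ ε` on `Q_r(T,x₀)` and `∫_{B(x₀,r)} |u(t)|² ≤ M r` for
a.e. `t ∈ (T−r², T)` (slice-wise `∫_{B_r}|u|³ ≤ ε (T−t)^{−1/2} M r`, Tonelli, `∫_{T−r²}^{T} (T−t)^{−1/2} dt = 2r`). -/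
theorem cknC_le_of_rate_of_morrey {u : ℝ → (EuclideanSpace ℝ (Fin 3)) → (EuclideanSpace ℝ (Fin 3))} {T : ℝ} {x₀ : (EuclideanSpace ℝ (Fin 3))} {r ε M : ℝ}
    (hr : 0 < r) (hε : 0 ≤ ε) (hM : 0 ≤ M)
    (hmeas : AEMeasurable (fun w : ℝ × (EuclideanSpace ℝ (Fin 3)) => ‖u w.1 w.2‖ₑ ^ (3 : ℕ))
      (volume.restrict (parabolicCylinder r (T, x₀))))
    (hsup : ∀ t ∈ Ioo (T - r ^ 2) T, ∀ x ∈ ball x₀ r, Real.sqrt (T - t) * ‖u t x‖ ≤ ε)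
    (hmor : ∀ᵐ t ∂(volume.restrict (Ioo (T - r ^ 2) T)),
      ∫⁻ x in ball x₀ r, ‖u t x‖ₑ ^ 2 ≤ ENNReal.ofReal (M * r)) :
    cknC r (T, x₀) u ≤ ENNReal.ofReal (2 * ε * M) := by
  -- slice bound
  have hslice : ∀ᵐ t ∂(volume.restrict (Ioo (T - r ^ 2) T)),
      ∫⁻ x in ball x₀ r, (fun w : ℝ × (EuclideanSpace ℝ (Fin 3)) => ‖u w.1 w.2‖ₑ ^ (3 : ℕ)) (t, x) ≤
        ENNReal.ofReal (ε * M * r) * ENNReal.ofReal ((T - t) ^ (-(1 / 2 : ℝ))) := by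
    filter_upwards [hmor, ae_restrict_mem measurableSet_Ioo] with t ht htI
    have hTt : 0 < T - t := by linarith [htI.2]
    have hst : 0 < Real.sqrt (T - t) := Real.sqrt_pos.2 hTt
    have hpt : ∀ x ∈ ball x₀ r,
        ‖u t x‖ₑ ^ (3 : ℕ) ≤ ENNReal.ofReal (ε / Real.sqrt (T - t)) * ‖u t x‖ₑ ^ 2 := by
      intro x hx
      have h1 : ‖u t x‖ ≤ ε / Real.sqrt (T - t) := by
        rw [le_div_iff₀ hst, mul_comm]; exact hsup t htI x hx
      calc ‖u t x‖ₑ ^ (3 : ℕ) = ‖u t x‖ₑ * ‖u t x‖ₑ ^ 2 := by ring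
        _ ≤ ENNReal.ofReal (ε / Real.sqrt (T - t)) * ‖u t x‖ₑ ^ 2 := by
            gcongr
            rw [← ofReal_norm]
            exact ENNReal.ofReal_le_ofReal h1
    calc ∫⁻ x in ball x₀ r, ‖u t x‖ₑ ^ (3 : ℕ)
        ≤ ∫⁻ x in ball x₀ r, ENNReal.ofReal (ε / Real.sqrt (T - t)) * ‖u t x‖ₑ ^ 2 :=
          setLIntegral_mono' measurableSet_ball hpt
      _ = ENNReal.ofReal (ε / Real.sqrt (T - t)) * ∫⁻ x in ball x₀ r, ‖u t x‖ₑ ^ 2 :=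
          lintegral_const_mul' _ _ ENNReal.ofReal_ne_top
      _ ≤ ENNReal.ofReal (ε / Real.sqrt (T - t)) * ENNReal.ofReal (M * r) :=
          by gcongr
      _ = ENNReal.ofReal (ε * M * r) * ENNReal.ofReal ((T - t) ^ (-(1 / 2 : ℝ))) := by
          rw [← ENNReal.ofReal_mul (by positivity), ← ENNReal.ofReal_mul (by positivity)]
          congr 1
          rw [Real.rpow_neg hTt.le, ← Real.sqrt_eq_rpow]
          field_simp
  -- Tonelli over the cylinder
  have hQ := RRS2016.lintegral_parabolicCylinder_le_of_ae_slice hmeas hslice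
  -- the time integral `∫_{T−r²}^{T} (T−t)^{−1/2} dt = 2r`
  have htime : ∫⁻ t in Ioo (T - r ^ 2) T, ENNReal.ofReal ((T - t) ^ (-(1 / 2 : ℝ))) =
      ENNReal.ofReal (2 * r) := by
    have hmp : MeasurePreserving (fun t : ℝ => t - (T - r ^ 2)) volume volume :=
      measurePreserving_sub_right volume _
    have hemb : MeasurableEmbedding (fun t : ℝ => t - (T - r ^ 2)) :=
      (MeasurableEquiv.subRight (T - r ^ 2)).measurableEmbedding
    have hpre : (fun t : ℝ => t - (T - r ^ 2)) ⁻¹' Ioo 0 (r ^ 2) = Ioo (T - r ^ 2) T := by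
      ext t; simp only [mem_preimage, mem_Ioo]; constructor <;> intro h <;> constructor <;> linarith [h.1, h.2]
    have h := hmp.setLIntegral_comp_preimage_emb hemb
      (fun σ : ℝ => ENNReal.ofReal ((r ^ 2 - σ) ^ (-(1 / 2 : ℝ)))) (Ioo 0 (r ^ 2))
    rw [hpre] at h
    have h' : ∫⁻ t in Ioo (T - r ^ 2) T, ENNReal.ofReal ((T - t) ^ (-(1 / 2 : ℝ))) =
        ∫⁻ t in Ioo (T - r ^ 2) T, ENNReal.ofReal ((r ^ 2 - (t - (T - r ^ 2))) ^ (-(1 / 2 : ℝ))) := by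
      refine lintegral_congr fun t => ?_
      congr 2; ring
    rw [h', h, lintegral_Ioo_ofReal_sub_rpow (pow_pos hr 2) (by norm_num)]
    congr 1
    have e : (-(1 / 2 : ℝ)) + 1 = 1 / 2 := by norm_num
    rw [e, ← Real.sqrt_eq_rpow, Real.sqrt_sq hr.le]
    ring
  have htot : ∫⁻ w in parabolicCylinder r (T, x₀), ‖u w.1 w.2‖ₑ ^ (3 : ℕ) ≤
      ENNReal.ofReal (2 * ε * M) * ENNReal.ofReal (r ^ 2) := by
    refine hQ.trans ?_
    rw [lintegral_const_mul' _ _ ENNReal.ofReal_ne_top, htime, ← ENNReal.ofReal_mul (by positivity),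
      ← ENNReal.ofReal_mul (by positivity)]
    exact ENNReal.ofReal_le_ofReal (by nlinarith)
  rw [cknC]
  have hr2 : ENNReal.ofReal r ^ 2 = ENNReal.ofReal (r ^ 2) := (ENNReal.ofReal_pow hr.le 2).symm
  rw [hr2]
  have h0 : ENNReal.ofReal (r ^ 2) ≠ 0 := (ENNReal.ofReal_pos.2 (pow_pos hr 2)).ne'
  calc (ENNReal.ofReal (r ^ 2))⁻¹ * ∫⁻ w in parabolicCylinder r (T, x₀), ‖u w.1 w.2‖ₑ ^ (3 : ℕ)
      ≤ (ENNReal.ofReal (r ^ 2))⁻¹ * (ENNReal.ofReal (2 * ε * M) * ENNReal.ofReal (r ^ 2)) := by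
        gcongr
    _ = ENNReal.ofReal (2 * ε * M) := by
        rw [mul_comm (ENNReal.ofReal (2 * ε * M)), ← mul_assoc,
          ENNReal.inv_mul_cancel h0 ENNReal.ofReal_ne_top, one_mul]

/-- Slices of a Leray–Hopf field: the lower Lebesgue integral of `|u(t)|²` over a ball is the
`ofReal` of the Bochner integral (`u(t) ∈ L²`). -/
theorem lintegral_ball_enorm_sq_eq_ofReal {v : (EuclideanSpace ℝ (Fin 3)) → (EuclideanSpace ℝ (Fin 3))} (hv : MemLp v 2 volume) (c : (EuclideanSpace ℝ (Fin 3))) (r : ℝ) :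
    ∫⁻ x in ball c r, ‖v x‖ₑ ^ 2 = ENNReal.ofReal (∫ x in ball c r, ‖v x‖ ^ 2) := by
  have hint : Integrable (fun x => ‖v x‖ ^ 2) (volume.restrict (ball c r)) :=
    ((memLp_two_iff_integrable_sq_norm hv.1).1 hv).integrableOn
  rw [ofReal_integral_eq_lintegral_ofReal hint (ae_of_all _ fun x => sq_nonneg _)]
  refine lintegral_congr fun x => ?_
  rw [← ofReal_norm, ENNReal.ofReal_pow (norm_nonneg _)]

/-- **`TypeITraceScarL3` at unit viscosity, in the class «terminal-layer energy below `√σ`»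
(nsreg-p2 g30, ROUND-33).**  Item `TerminalTrace.TypeITraceScarL3` with `ν = 1`, restricted to the
class of singular points `x₀` where (a) `u(t,·)` has Lipschitz modulus `≤ C_g/(T−t)` on `B(x₀,2ρ)`
(the gradient companion of Type I), (b) the terminal-layer dial can be turned below `√σ`:
for every `ε > 0` some `σ = τ² ≤ 1` with `λ⁻¹ ∫_{B(x,λ)} |u(T−σλ²)|² ≤ ε √σ` for all small `λ` and all
`x ∈ B(x₀,ρ)`, and (c) the printed pressure class `p ∈ L^{3/2}(Q_R(T,x₀))` at one scale.  In that
class there is NO singular point at all — the conclusion holds vacuously; the proof USES Type I three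
times (Morrey bound `morrey_of_typeI`; finiteness of `C(r₀)`; Seregin's Prop. 3.11 (i)
`scaledEnergies_bounded_of_typeIRate`) and closes with Seregin's cubic floor at a backward singular
point (`Seregin2020.exists_le_cknC_of_isBackwardSingularPoint`) against `C(r) ≤ 2εM₀`
(`cknC_le_of_rate_of_morrey` fed by `subTypeI_of_layerDecay`).  The terminal `L³` hypothesis is idle.
General `ν > 0` follows by the Navier–Stokes scaling (not typed here).
[cite: Seregin2020, proof of Thm. 2.1 (2.9); Seregin2014, Ch. 6 §6.3 Prop. 3.11 (i); CKN1982] -/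
theorem typeITraceScarL3_unitViscosity_of_layerDecay :
    ∀ T : ℝ, 0 < T →
    ∀ (u : ℝ → (EuclideanSpace ℝ (Fin 3)) → (EuclideanSpace ℝ (Fin 3))) (p : ℝ → (EuclideanSpace ℝ (Fin 3)) → ℝ),
      IsClassicalNSSolutionOn (Set.Ico 0 T) 1 0 u p →
      IsLerayHopfOn T 1 0 (u 0) u →
      HasRapidSpatialDecay (u 0) →
      IsTypeIBlowup u T →
      ∀ x₀ : (EuclideanSpace ℝ (Fin 3)),
        -- the class (a) + (b): gradient companion and the terminal-layer dial below `√σ`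
        (∃ ρ Cg T₀ : ℝ, 0 < ρ ∧ 0 < Cg ∧ T₀ < T ∧
          (∀ t ∈ Ioo T₀ T, ∀ x ∈ ball x₀ ρ, ∀ y ∈ ball x₀ (2 * ρ),
            ‖u t x‖ - ‖u t y‖ ≤ Cg / (T - t) * dist y x) ∧
          (∀ ε : ℝ, 0 < ε → ∃ τ : ℝ, 0 < τ ∧ τ ≤ 1 ∧ ∃ l₁ : ℝ, 0 < l₁ ∧
            ∀ l : ℝ, 0 < l → l ≤ l₁ → ∀ x ∈ ball x₀ ρ,
              ∫⁻ y in ball x l, ‖u (T - τ ^ 2 * l ^ 2) y‖ₑ ^ 2 ≤ ENNReal.ofReal (ε * τ * l))) →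
        -- the class (c): printed pressure class at one scale
        (∃ R : ℝ, 0 < R ∧ R ^ 2 ≤ T ∧
          MemLp (Function.uncurry p) (3 / 2) (volume.restrict (parabolicCylinder R (T, x₀)))) →
        (∀ r : ℝ, 0 < r → eLpNorm (Function.uncurry u) ⊤
          (volume.restrict (parabolicCylinder r (T, x₀))) = ⊤) →
        ∀ ρ' : ℝ, 0 < ρ' → ¬ MemLp (u T) 3 (volume.restrict (ball x₀ ρ')) := by
  intro T hT u p hcl hLH _hdec hTI x₀ hclass hpress hsing ρ' _hρ' _hL3
  obtain ⟨ρ, Cg, T₀, hρ, hCg, hT₀, hlip, hlayer⟩ := hclass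
  obtain ⟨R, hR, hRT, hpL⟩ := hpress
  -- (1) locally sub-Type-I at `x₀` (the dial below `√σ`)
  have hsub := subTypeI_of_layerDecay hρ hCg hT₀ hlip hlayer
  -- (2) the Type-I rate window and the Morrey bound (Type I used)
  obtain ⟨C, δ, hC0, hδ, hδT, hrate⟩ := exists_typeI_rate_window hT hTI
  obtain ⟨rM, M₀, TM, hrM, hTM, hmorB⟩ := morrey_of_typeI one_pos hT hcl hLH hTI
  set M : ℝ := max M₀ 0 with hM_def
  have hM0 : 0 ≤ M := le_max_right _ _
  have hmor : ∀ t ∈ Ioo TM T, 0 ≤ t → ∀ r : ℝ, 0 < r → r ≤ rM →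
      ∫⁻ x in ball x₀ r, ‖u t x‖ₑ ^ 2 ≤ ENNReal.ofReal (M * r) := by
    intro t ht ht0 r hr hrr
    rw [lintegral_ball_enorm_sq_eq_ofReal (hLH.memLp t ⟨ht0, ht.2.le⟩)]
    refine ENNReal.ofReal_le_ofReal ((hmorB t ht x₀ r hr hrr).trans ?_)
    exact mul_le_mul_of_nonneg_right (le_max_left _ _) hr.le
  -- (3) the working radius `r₀`
  set W : ℝ := min δ (T - TM) with hW_def
  have hW : 0 < W := lt_min hδ (sub_pos.2 hTM)
  set r₀ : ℝ := min (min R rM) (Real.sqrt W / 2) with hr₀_def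
  have hr₀ : 0 < r₀ := lt_min (lt_min hR hrM) (by positivity)
  have hr₀R : r₀ ≤ R := (min_le_left _ _).trans (min_le_left _ _)
  have hr₀M : r₀ ≤ rM := (min_le_left _ _).trans (min_le_right _ _)
  have hr₀W : r₀ ^ 2 < W := by
    have h1 : r₀ ≤ Real.sqrt W / 2 := min_le_right _ _
    have h2 : (Real.sqrt W) ^ 2 = W := Real.sq_sqrt hW.le
    nlinarith [Real.sqrt_nonneg W]
  have hr₀δ : r₀ ^ 2 < δ := hr₀W.trans_le (min_le_left _ _)
  have hr₀TM : TM < T - r₀ ^ 2 := by linarith [min_le_right δ (T - TM)]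
  have hr₀T : r₀ ^ 2 ≤ T := (hr₀δ.le.trans hδT)
  -- (4) the suitable weak solution on `Q₀ = Q_{r₀}(T,x₀)` (unit viscosity), its weak gradient
  have hsubQ : parabolicCylinder r₀ (T, x₀) ⊆ Set.Ico 0 T ×ˢ (univ : Set (EuclideanSpace ℝ (Fin 3))) := by
    intro z hz
    rw [mem_parabolicCylinder] at hz
    refine mem_prod.2 ⟨⟨?_, hz.1.2⟩, mem_univ _⟩
    have h1 : T - r₀ ^ 2 < z.1 := hz.1.1
    linarith
  have hreg : IsClassicalNSSolutionOnRegion (parabolicCylinder r₀ (T, x₀)) 1 0 u p :=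
    hcl.onRegion.mono_of_isOpen hsubQ (isOpen_parabolicCylinder r₀ (T, x₀))
  have hsw : IsSuitableWeakSolutionOn (parabolicCylinderOpens r₀ (T, x₀)) 1 0 u p :=
    hreg.isSuitableWeakSolutionOn (isOpen_parabolicCylinder r₀ (T, x₀)) one_pos
  have hQ₀ : parabolicCylinder r₀ (T, x₀) ⊆
      ((parabolicCylinderOpens r₀ (T, x₀) : TopologicalSpace.Opens (ℝ × (EuclideanSpace ℝ (Fin 3)))) : Set (ℝ × (EuclideanSpace ℝ (Fin 3)))) := by
    rw [coe_parabolicCylinderOpens]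
  obtain ⟨G, hGslab, -, hGint, -⟩ := hLH.exists_hasWeakSpatialGradientOn
  have hQslab : parabolicCylinder r₀ (T, x₀) ⊆ Ioo 0 T ×ˢ (univ : Set (EuclideanSpace ℝ (Fin 3))) := by
    intro z hz
    rw [mem_parabolicCylinder] at hz
    refine mem_prod.2 ⟨⟨?_, hz.1.2⟩, mem_univ _⟩
    have h1 : T - r₀ ^ 2 < z.1 := hz.1.1
    linarith
  have hG : HasWeakSpatialGradientOn (parabolicCylinderOpens r₀ (T, x₀)) u G :=
    hGslab.mono (fun z hz => mem_slab.2 (mem_prod.1 (hQslab hz)).1)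
  -- (5) finiteness at scale `r₀`: `D` from the printed pressure class, `C` from Type I + Morrey
  have hDfin : cknD r₀ (T, x₀) p < ⊤ := by
    rw [cknD]
    refine ENNReal.mul_lt_top
      (ENNReal.inv_lt_top.2 (ENNReal.pow_pos (ENNReal.ofReal_pos.2 hr₀) _)) ?_
    have h32 : ((3 : ℝ≥0∞) / 2).toReal = (3 / 2 : ℝ) := by
      rw [ENNReal.toReal_div]; norm_num
    have hI := lintegral_rpow_enorm_lt_top_of_eLpNorm_lt_top (by norm_num)
      (ENNReal.div_lt_top (by norm_num) (by norm_num)).ne hpL.2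
    rw [h32] at hI
    refine lt_of_le_of_lt (lintegral_mono_set (parabolicCylinder_mono hr₀.le hr₀R _)) ?_
    simpa [Function.uncurry] using hI
  have hmeasQ : ∀ r : ℝ, 0 < r → r ≤ r₀ → AEMeasurable (fun w : ℝ × (EuclideanSpace ℝ (Fin 3)) => ‖u w.1 w.2‖ₑ ^ (3 : ℕ))
      (volume.restrict (parabolicCylinder r (T, x₀))) := by
    intro r hr hrr
    have hu : AEStronglyMeasurable (uncurry u) (volume.restrict (parabolicCylinder r (T, x₀))) :=
      hsw.distributional.1.aestronglyMeasurable.mono_measure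
        (Measure.restrict_mono ((parabolicCylinder_mono hr.le hrr _).trans hQ₀) le_rfl)
    exact (hu.enorm.pow_const 3 : AEMeasurable (fun w : ℝ × (EuclideanSpace ℝ (Fin 3)) => ‖uncurry u w‖ₑ ^ (3 : ℕ)) _)
  have hrateQ : ∀ r : ℝ, 0 < r → r ≤ r₀ → ∀ t ∈ Ioo (T - r ^ 2) T, ∀ x ∈ ball x₀ r,
      Real.sqrt (T - t) * ‖u t x‖ ≤ C := by
    intro r hr hrr t ht x _
    refine hrate t ⟨?_, ht.2⟩ x
    have : r ^ 2 ≤ r₀ ^ 2 := pow_le_pow_left₀ hr.le hrr 2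
    linarith [ht.1]
  have hmorQ : ∀ r : ℝ, 0 < r → r ≤ r₀ → ∀ᵐ t ∂(volume.restrict (Ioo (T - r ^ 2) T)),
      ∫⁻ x in ball x₀ r, ‖u t x‖ₑ ^ 2 ≤ ENNReal.ofReal (M * r) := by
    intro r hr hrr
    filter_upwards [ae_restrict_mem measurableSet_Ioo] with t ht
    have : r ^ 2 ≤ r₀ ^ 2 := pow_le_pow_left₀ hr.le hrr 2
    exact hmor t ⟨by linarith [ht.1], ht.2⟩ (by linarith [ht.1]) r hr (hrr.trans hr₀M)
  have hCfin : cknC r₀ (T, x₀) u < ⊤ :=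
    lt_of_le_of_lt (cknC_le_of_rate_of_morrey hr₀ hC0 hM0 (hmeasQ r₀ hr₀ le_rfl)
      (hrateQ r₀ hr₀ le_rfl) (hmorQ r₀ hr₀ le_rfl)) ENNReal.ofReal_lt_top
  -- (6) Seregin 2014 Prop. 3.11 (i): the Type-I rate bounds `A + E + C + D` on `Q_r`, `r < r₀/2`
  have hI' : ∃ c : ℝ, ∀ᵐ w ∂(volume.restrict (parabolicCylinder r₀ (T, x₀))),
      Real.sqrt ((T, x₀).1 - w.1) * ‖u w.1 w.2‖ ≤ c := by
    refine ⟨C, (ae_restrict_mem (isOpen_parabolicCylinder r₀ (T, x₀)).measurableSet).mono fun w hw => ?_⟩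
    rw [mem_parabolicCylinder] at hw
    exact hrate w.1 ⟨by linarith [hw.1.1], hw.1.2⟩ w.2
  obtain ⟨K, hK⟩ := scaledEnergies_bounded_of_typeIRate hsw hG hr₀ hQ₀ hCfin.ne hDfin.ne hI'
  -- (7) Seregin's cubic floor at the backward singular point `(T,x₀)` with `L := K`
  set r₁ : ℝ := r₀ / 4 with hr₁_def
  have hr₁ : 0 < r₁ := by positivity
  have hr₁h : r₁ < r₀ / 2 := by rw [hr₁_def]; linarith
  have hr₁r₀ : r₁ ≤ r₀ := by rw [hr₁_def]; linarith
  have hK₁ := hK r₁ ⟨hr₁, hr₁h⟩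
  have hA₁ : cknAEss r₁ (T, x₀) u ≠ ⊤ :=
    ne_top_of_le_ne_top ENNReal.coe_ne_top
      ((le_add_of_nonneg_right (by positivity)).trans
        ((le_add_of_nonneg_right (by positivity)).trans ((le_add_of_nonneg_right (by positivity)).trans hK₁)))
  have hE₁ : cknE r₁ (T, x₀) G ≠ ⊤ := by
    refine ne_top_of_le_ne_top ENNReal.coe_ne_top (le_trans ?_ hK₁)
    calc cknE r₁ (T, x₀) G ≤ cknAEss r₁ (T, x₀) u + cknE r₁ (T, x₀) G := le_add_self
      _ ≤ cknAEss r₁ (T, x₀) u + cknE r₁ (T, x₀) G + cknC r₁ (T, x₀) u := le_self_add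
      _ ≤ _ := le_self_add
  have hD₁ : ∀ r ∈ Ioc (0 : ℝ) r₁, cknD r (T, x₀) p ≤ (K : ℝ≥0∞) := by
    intro r hr
    exact le_trans le_add_self (hK r ⟨hr.1, lt_of_le_of_lt hr.2 hr₁h⟩)
  have hsing' : IsBackwardSingularPoint u (T, x₀) := fun r hr => hsing r hr
  obtain ⟨κ, hκ, Hfloor⟩ := Seregin2020.exists_le_cknC_of_isBackwardSingularPoint K
  have hfloor := Hfloor _ u p G hsw hG (T, x₀) r₁ hr₁
    ((parabolicCylinder_mono hr₁.le hr₁r₀ _).trans hQ₀) hA₁ hE₁ hD₁ hsing'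
  -- (8) turn the dial: `ε_g` with `2 ε_g M < κ`
  set εg : ℝ := κ / (4 * (M + 1)) with hεg_def
  have hεg : 0 < εg := by positivity
  have hεgM : 2 * εg * M < κ := by
    rw [hεg_def]
    have hM1 : 0 < M + 1 := by linarith
    have : 2 * (κ / (4 * (M + 1))) * M = κ * (M / (M + 1)) / 2 := by field_simp; ring
    rw [this]
    have hfrac : M / (M + 1) < 1 := by rw [div_lt_one hM1]; linarith
    nlinarith [mul_lt_mul_of_pos_left hfrac hκ]
  obtain ⟨T₁, hT₁, hsmall⟩ := hsub εg hεg
  set W₁ : ℝ := T - T₁ with hW₁_def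
  have hW₁ : 0 < W₁ := sub_pos.2 hT₁
  set r : ℝ := min (min r₁ ρ) (Real.sqrt W₁ / 2) with hr_def
  have hr : 0 < r := lt_min (lt_min hr₁ hρ) (by positivity)
  have hrr₁ : r ≤ r₁ := (min_le_left _ _).trans (min_le_left _ _)
  have hrρ : r ≤ ρ := (min_le_left _ _).trans (min_le_right _ _)
  have hrr₀ : r ≤ r₀ := hrr₁.trans hr₁r₀
  have hrW₁ : r ^ 2 < W₁ := by
    have h1 : r ≤ Real.sqrt W₁ / 2 := min_le_right _ _
    have h2 : (Real.sqrt W₁) ^ 2 = W₁ := Real.sq_sqrt hW₁.le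
    nlinarith [Real.sqrt_nonneg W₁]
  -- `C(r) ≤ 2 ε_g M` from the sub-Type-I bound and Morrey
  have hsupr : ∀ t ∈ Ioo (T - r ^ 2) T, ∀ x ∈ ball x₀ r, Real.sqrt (T - t) * ‖u t x‖ ≤ εg := by
    intro t ht x hx
    exact hsmall t ⟨by linarith [ht.1], ht.2⟩ x (ball_subset_ball hrρ hx)
  have hCle : cknC r (T, x₀) u ≤ ENNReal.ofReal (2 * εg * M) :=
    cknC_le_of_rate_of_morrey hr hεg.le hM0 (hmeasQ r hr hrr₀) hsupr (hmorQ r hr hrr₀)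
  -- against the floor `κ ≤ C(r)`
  have hge : ENNReal.ofReal κ ≤ cknC r (T, x₀) u := hfloor r ⟨hr, hrr₁⟩
  have : κ ≤ 2 * εg * M := (ENNReal.ofReal_le_ofReal_iff (by positivity)).1 (hge.trans hCle)
  linarith

end Summit.NavierStokesRegularity.NavierStokesRegularity.Theorems.TypeITraceScarL3

end
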